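import Mathlib
import Literature.NumberTheory.Transcendental.OneMotiveToricProofs

/-!
# Route `TateNomes`, crux `NomeHygiene`, line `integer_shift_rebase`:
# stub `stub_shiftedTateBasis` — the shifted Tate basis (construction, given the Key Lemma)

(item stmt-Schanuel-17298, route route-Schanuel-TateNomes; skeleton
`Summits/Schanuel/Schanuel/Cruxes/NomeHygiene/Lines/integer_shift_rebase.lean`, registered stub
`stub_shiftedTateBasis`, proved here verbatim — name and uncurried signature.)

## Statement

Assume the Key Lemma (registered stub `stub_shiftCoincidence`, verbatim, as a hypothesis).  Let
`(2πi, 1, u₁, …, u_m)` be `ℚ`-linearly independent with `m ≥ 1`.  Then its `ℚ`-span has a basis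
`w : Fin (m+2) → ℂ` in Tate position: `Re wⱼ < 0`, every `wⱼ/2πi` transcendental, and the
`wⱼ/2πi` pairwise unrelated under `GL₂⁺(ℚ)` (polynomial form, both orders).

## Proof

Slots `s = 0, …, m+1` with base points `β_s = u_s (s < m)`, `β_m = 2πi + u₀`,
`β_{m+1} = 4πi + u₀`, and `w_s = β_s − t_s` with natural numbers `t_s` chosen one slot at a time
(`slot_step`, `slot_all`) outside a finite bad set: `t ≤ Re β_s` (finitely many), `(β_s − t)/2πi`
algebraic (at most one `t`, since `2πi` is transcendental), `(β_s − t)/2πi` related to an earlier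
`(β_{s'} − t_{s'})/2πi` (finitely many by the Key Lemma at `(β, p) = (β_s, τ_{s'})`, whose
hypothesis `(1, 2πi, β_s)` independent holds because `β_s = k·2πi + u_j` — `slot_indep`), and for
the last slot the one value `t_{m+1} = 2 t_m − t_0`.  Then `w_{m+1} − 2 w_m + w_0 = 2t_m − t_0 −
t_{m+1} =: δ ∈ ℚ∖{0}`, so `1 ∈ span w`, hence `u_j = w_j + t_j`, `2πi = w_m − u₀ + t_m ∈ span w`:
`span w = span (2πi, 1, u)`, and `w` is independent by the `finrank` count.
-/

noncomputable section

-- `Summit.Schanuel.Schanuel.…` is the mandated summit/sub-problem namespace (single-conjunct summit), hence: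
set_option linter.dupNamespace false

namespace Summit.Schanuel.Schanuel.Theorems.TateNomesNomeHygiene

open Complex

/-! ## Coefficients against the basis `(T, 1, u)` -/

/-- Reading off coefficients of `T`, `1`, `u j` from the independence of `(T, 1, u)`. -/
theorem basis_coeff {T : ℂ} {m : ℕ} {u : Fin m → ℂ}
    (hu : LinearIndependent ℚ (Fin.cons T (Fin.cons (1 : ℂ) u) : Fin (m + 2) → ℂ))
    (a b q : ℚ) (j : Fin m) (h : (a : ℂ) * T + b + q * u j = 0) : a = 0 ∧ b = 0 ∧ q = 0 := by
  classical
  have hsum : ∑ i, (Fin.cons a (Fin.cons b (Pi.single j q)) : Fin (m + 2) → ℚ) i •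
      (Fin.cons T (Fin.cons (1 : ℂ) u) : Fin (m + 2) → ℂ) i = 0 := by
    rw [Fin.sum_univ_succ, Fin.sum_univ_succ]
    simp only [Fin.cons_zero, Fin.cons_succ]
    rw [Finset.sum_eq_single j]
    · simp only [Pi.single_eq_same, Rat.smul_def, mul_one]
      linear_combination h
    · intro i _ hij
      simp [hij]
    · intro hj
      exact absurd (Finset.mem_univ j) hj
  have h0 := Fintype.linearIndependent_iff.1 hu _ hsum
  have ea := h0 0
  have eb := h0 (Fin.succ 0)
  have eq := h0 (j.succ.succ)
  simp only [Fin.cons_zero, Fin.cons_succ, Pi.single_eq_same] at ea eb eq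
  exact ⟨ea, eb, eq⟩

/-- Every slot base point `β = k·T + u j` keeps `(1, T, β)` independent. -/
theorem slot_indep {T : ℂ} {m : ℕ} {u : Fin m → ℂ}
    (hu : LinearIndependent ℚ (Fin.cons T (Fin.cons (1 : ℂ) u) : Fin (m + 2) → ℂ))
    (β : ℂ) (k : ℚ) (j : Fin m) (hβ : β = (k : ℂ) * T + u j) :
    LinearIndependent ℚ ![(1 : ℂ), T, β] := by
  subst hβ
  rw [Fintype.linearIndependent_iff]
  intro g hg
  rw [Fin.sum_univ_three] at hg
  simp only [Matrix.cons_val_zero, Matrix.cons_val_one, Matrix.head_cons, Matrix.cons_val_two,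
    Matrix.tail_cons, Rat.smul_def] at hg
  obtain ⟨h1, h0, h2⟩ :=
    basis_coeff hu (g 1 + k * g 2) (g 0) (g 2) j (by push_cast; linear_combination hg)
  have g1 : g 1 = 0 := by
    rw [h2, mul_zero, add_zero] at h1
    exact h1
  intro i
  fin_cases i
  · exact h0
  · exact g1
  · exact h2

/-! ## The sequential choice of the integer shifts -/

/-! The slot invariant after the first `s` shifts `t 0, …, t (s-1)` have been chosen is the
conjunction of: real parts beaten (`Re β_i < t_i`), transcendental nomes, no `GL₂⁺(ℚ)`-relation
with an earlier slot (both orders), and — once all `m + 2` slots are set — the basis condition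
`t_{m+1} ≠ 2 t_m − t_0`.  It is written out verbatim in `slot_step` / `slot_all` (no auxiliary
`def`, so that the file carries no Prop-valued definitions). -/

/-- One more slot: the bad shifts form a finite set, so a good natural number exists. -/
theorem slot_step {T : ℂ} (hT : Transcendental ℚ T) (hT0 : T ≠ 0) {β : ℕ → ℂ} {m : ℕ}
    (hK : ∀ (s : ℕ) (p : ℂ), Set.Finite {q : ℚ | ∃ a b c d : ℚ, 0 < a * d - b * c ∧
        ((β s - (q : ℂ)) / T * ((c : ℂ) * p + (d : ℂ)) = (a : ℂ) * p + (b : ℂ) ∨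
         p * ((c : ℂ) * ((β s - (q : ℂ)) / T) + (d : ℂ)) =
           (a : ℂ) * ((β s - (q : ℂ)) / T) + (b : ℂ))})
    (t : ℕ → ℕ) (s : ℕ)
    (h : ((∀ i < s, (β i).re < t i) ∧
      (∀ i < s, Transcendental ℚ ((β i - t i) / T)) ∧
      (∀ i < s, ∀ i' < i, ¬ ∃ a b c d : ℚ, 0 < a * d - b * c ∧
        ((β i - t i) / T * ((c : ℂ) * ((β i' - t i') / T) + d) = (a : ℂ) * ((β i' - t i') / T) + b ∨
         (β i' - t i') / T * ((c : ℂ) * ((β i - t i) / T) + d) = (a : ℂ) * ((β i - t i) / T) + b)) ∧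
      (m + 2 ≤ s → (t (m + 1) : ℚ) ≠ 2 * t m - t 0))) :
    ∃ t' : ℕ → ℕ, (∀ i < s, t' i = t i) ∧
      ((∀ i < (s + 1), (β i).re < t' i) ∧
      (∀ i < (s + 1), Transcendental ℚ ((β i - t' i) / T)) ∧
      (∀ i < (s + 1), ∀ i' < i, ¬ ∃ a b c d : ℚ, 0 < a * d - b * c ∧
        ((β i - t' i) / T * ((c : ℂ) * ((β i' - t' i') / T) + d) = (a : ℂ) * ((β i' - t' i') / T) + b ∨
         (β i' - t' i') / T * ((c : ℂ) * ((β i - t' i) / T) + d) = (a : ℂ) * ((β i - t' i) / T) + b)) ∧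
      (m + 2 ≤ (s + 1) → (t' (m + 1) : ℚ) ≠ 2 * t' m - t' 0)) := by
  classical
  obtain ⟨hre, htr, hrel, hdet⟩ := h
  -- the four finite bad sets
  have hB₁ : Set.Finite {n : ℕ | (n : ℝ) ≤ (β s).re} := by
    refine (Set.finite_Iic ⌈(β s).re⌉₊).subset ?_
    intro n hn
    rw [Set.mem_setOf_eq] at hn
    exact Nat.cast_le.1 (hn.trans (Nat.le_ceil _))
  have hB₂ : Set.Finite {n : ℕ | IsAlgebraic ℚ ((β s - n) / T)} := by
    refine Set.Subsingleton.finite ?_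
    intro n hn n' hn'
    rw [Set.mem_setOf_eq] at hn hn'
    by_contra hne
    have hne' : ((n' : ℂ) - n) ≠ 0 := by
      rw [sub_ne_zero]
      exact_mod_cast (Ne.symm hne)
    have hdiff : IsAlgebraic ℚ (((n' : ℂ) - n) / T) := by
      have := hn.sub hn'
      have e : (β s - n) / T - (β s - n') / T = ((n' : ℂ) - n) / T := by
        field_simp
        ring
      rw [e] at this
      exact this
    have hrat : IsAlgebraic ℚ ((n' : ℂ) - n) := (isAlgebraic_nat n').sub (isAlgebraic_nat n)
    apply hT
    have e : T = ((n' : ℂ) - n) * ((((n' : ℂ) - n) / T))⁻¹ := by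
      field_simp
    rw [e]
    exact hrat.mul hdiff.inv
  have hB₃ : Set.Finite (⋃ i ∈ Finset.range s, ((Nat.cast : ℕ → ℚ) ⁻¹'
      {q : ℚ | ∃ a b c d : ℚ, 0 < a * d - b * c ∧
        ((β s - (q : ℂ)) / T * ((c : ℂ) * ((β i - t i) / T) + (d : ℂ)) =
            (a : ℂ) * ((β i - t i) / T) + (b : ℂ) ∨
         (β i - t i) / T * ((c : ℂ) * ((β s - (q : ℂ)) / T) + (d : ℂ)) =
            (a : ℂ) * ((β s - (q : ℂ)) / T) + (b : ℂ))})) := by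
    refine Set.Finite.biUnion (Finset.range s).finite_toSet (fun i _ => ?_)
    exact (hK s ((β i - t i) / T)).preimage Nat.cast_injective.injOn
  have hB₄ : Set.Finite {n : ℕ | (n : ℚ) = 2 * t m - t 0} :=
    Set.Subsingleton.finite (fun n hn n' hn' => Nat.cast_injective (R := ℚ) (hn.trans hn'.symm))
  obtain ⟨n, hn⟩ := (((hB₁.union hB₂).union (hB₃.union hB₄)).infinite_compl).nonempty
  simp only [Set.mem_compl_iff, Set.mem_union, Set.mem_setOf_eq, not_or, Set.mem_iUnion,
    Set.mem_preimage, not_exists, Finset.mem_range] at hn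
  obtain ⟨⟨hn1, hn2⟩, hn3, hn4⟩ := hn
  -- the new assignment
  refine ⟨Function.update t s n, fun i hi => Function.update_of_ne (ne_of_lt hi) _ _, ?_, ?_, ?_, ?_⟩
  · intro i hi
    rcases (Nat.lt_succ_iff.1 hi).lt_or_eq with hi | rfl
    · rw [Function.update_of_ne (ne_of_lt hi)]
      exact hre i hi
    · rw [Function.update_self]
      exact not_le.1 hn1
  · intro i hi
    rcases (Nat.lt_succ_iff.1 hi).lt_or_eq with hi | rfl
    · rw [Function.update_of_ne (ne_of_lt hi)]
      exact htr i hi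
    · rw [Function.update_self]
      exact hn2
  · intro i hi i' hi'
    rcases (Nat.lt_succ_iff.1 hi).lt_or_eq with hi | rfl
    · rw [Function.update_of_ne (ne_of_lt hi), Function.update_of_ne (ne_of_lt (hi'.trans hi))]
      exact hrel i hi i' hi'
    · rw [Function.update_self, Function.update_of_ne (ne_of_lt hi')]
      have := hn3 i' hi'
      simpa only [Rat.cast_natCast, not_exists] using this
  · intro hs
    by_cases hs' : m + 2 ≤ s
    · rw [Function.update_of_ne (by omega : m + 1 ≠ s), Function.update_of_ne (by omega : m ≠ s),
        Function.update_of_ne (by omega : 0 ≠ s)]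
      exact hdet hs'
    · obtain rfl : s = m + 1 := by omega
      rw [Function.update_self, Function.update_of_ne (by omega : m ≠ m + 1),
        Function.update_of_ne (by omega : 0 ≠ m + 1)]
      exact hn4

/-- All slots: by induction from the empty assignment. -/
theorem slot_all {T : ℂ} (hT : Transcendental ℚ T) (hT0 : T ≠ 0) {β : ℕ → ℂ} {m : ℕ}
    (hK : ∀ (s : ℕ) (p : ℂ), Set.Finite {q : ℚ | ∃ a b c d : ℚ, 0 < a * d - b * c ∧
        ((β s - (q : ℂ)) / T * ((c : ℂ) * p + (d : ℂ)) = (a : ℂ) * p + (b : ℂ) ∨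
         p * ((c : ℂ) * ((β s - (q : ℂ)) / T) + (d : ℂ)) =
           (a : ℂ) * ((β s - (q : ℂ)) / T) + (b : ℂ))}) :
    ∀ s : ℕ, ∃ t : ℕ → ℕ,
      ((∀ i < s, (β i).re < t i) ∧
      (∀ i < s, Transcendental ℚ ((β i - t i) / T)) ∧
      (∀ i < s, ∀ i' < i, ¬ ∃ a b c d : ℚ, 0 < a * d - b * c ∧
        ((β i - t i) / T * ((c : ℂ) * ((β i' - t i') / T) + d) = (a : ℂ) * ((β i' - t i') / T) + b ∨
         (β i' - t i') / T * ((c : ℂ) * ((β i - t i) / T) + d) = (a : ℂ) * ((β i - t i) / T) + b)) ∧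
      (m + 2 ≤ s → (t (m + 1) : ℚ) ≠ 2 * t m - t 0)) := by
  intro s
  induction s with
  | zero =>
    refine ⟨fun _ => 0, ?_, ?_, ?_, ?_⟩
    · intro i hi; omega
    · intro i hi; omega
    · intro i hi; omega
    · intro h; omega
  | succ s ih =>
    obtain ⟨t, ht⟩ := ih
    obtain ⟨t', -, ht'⟩ := slot_step hT hT0 hK t s ht
    exact ⟨t', ht'⟩

/-! ## The registered stub -/

/-- **`stub_shiftedTateBasis`** (construction stub of line `integer_shift_rebase`, registered on
stmt-Schanuel-17298; name and signature verbatim): the Key Lemma implies that the span of a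
`ℚ`-independent `(2πi, 1, u₁, …, u_m)`, `m ≥ 1`, has a Tate-position basis with transcendental
nomes. -/
theorem stub_shiftedTateBasis :
    (∀ (β p : ℂ), LinearIndependent ℚ ![(1 : ℂ), 2 * (Real.pi : ℂ) * Complex.I, β] →
      Set.Finite {t : ℚ | ∃ a b c d : ℚ, 0 < a * d - b * c ∧
        ((β - (t : ℂ)) / (2 * (Real.pi : ℂ) * Complex.I) * ((c : ℂ) * p + (d : ℂ)) =
            (a : ℂ) * p + (b : ℂ) ∨
         p * ((c : ℂ) * ((β - (t : ℂ)) / (2 * (Real.pi : ℂ) * Complex.I)) + (d : ℂ)) =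
            (a : ℂ) * ((β - (t : ℂ)) / (2 * (Real.pi : ℂ) * Complex.I)) + (b : ℂ))}) →
    ∀ (m : ℕ) (u : Fin m → ℂ), 1 ≤ m →
      LinearIndependent ℚ
        (Fin.cons (2 * (Real.pi : ℂ) * Complex.I) (Fin.cons (1 : ℂ) u) : Fin (m + 2) → ℂ) →
      ∃ w : Fin (m + 2) → ℂ, LinearIndependent ℚ w ∧
        Submodule.span ℚ (Set.range w) = Submodule.span ℚ (Set.range
          (Fin.cons (2 * (Real.pi : ℂ) * Complex.I) (Fin.cons (1 : ℂ) u) : Fin (m + 2) → ℂ)) ∧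
        (∀ j, (w j).re < 0) ∧
        (∀ j, Transcendental ℚ (w j / (2 * (Real.pi : ℂ) * Complex.I))) ∧
        (∀ i j, i ≠ j → ∀ a b c d : ℚ, 0 < a * d - b * c →
          (w j / (2 * (Real.pi : ℂ) * Complex.I)) *
              ((c : ℂ) * (w i / (2 * (Real.pi : ℂ) * Complex.I)) + (d : ℂ)) ≠
            (a : ℂ) * (w i / (2 * (Real.pi : ℂ) * Complex.I)) + (b : ℂ)) := by
  intro hK0 m u hm hu
  set T : ℂ := 2 * (Real.pi : ℂ) * Complex.I with hT
  have hT0 : T ≠ 0 := by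
    rw [hT]
    exact Complex.two_pi_I_ne_zero
  have hTt : Transcendental ℚ T := by
    rw [hT]
    exact Literature.NumberTheory.Transcendental.transcendental_two_pi_I
  -- the slots
  set j0 : Fin m := ⟨0, by omega⟩ with hj0
  set β : ℕ → ℂ := fun s => if h : s < m then u ⟨s, h⟩ else if s = m then T + u j0 else 2 * T + u j0
    with hβ
  have hβlt : ∀ (s : ℕ) (h : s < m), β s = u ⟨s, h⟩ := by
    intro s h
    simp [hβ, h]
  have hβm : β m = T + u j0 := by
    simp [hβ]
  have hβgt : ∀ s : ℕ, m < s → β s = 2 * T + u j0 := by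
    intro s h
    simp [hβ, not_lt.2 h.le, Nat.ne_of_gt h]
  -- every slot base keeps `(1, T, β s)` independent, so the Key Lemma applies at every slot
  have hβind : ∀ s : ℕ, LinearIndependent ℚ ![(1 : ℂ), T, β s] := by
    intro s
    rcases lt_trichotomy s m with h | rfl | h
    · exact slot_indep hu (β s) 0 ⟨s, h⟩ (by rw [hβlt s h]; push_cast; ring)
    · exact slot_indep hu (β s) 1 j0 (by rw [hβm]; push_cast; ring)
    · exact slot_indep hu (β s) 2 j0 (by rw [hβgt s h]; push_cast; ring)
  have hK : ∀ (s : ℕ) (p : ℂ), Set.Finite {q : ℚ | ∃ a b c d : ℚ, 0 < a * d - b * c ∧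
      ((β s - (q : ℂ)) / T * ((c : ℂ) * p + (d : ℂ)) = (a : ℂ) * p + (b : ℂ) ∨
       p * ((c : ℂ) * ((β s - (q : ℂ)) / T) + (d : ℂ)) =
         (a : ℂ) * ((β s - (q : ℂ)) / T) + (b : ℂ))} :=
    fun s p => hK0 (β s) p (hβind s)
  -- choose the shifts
  obtain ⟨t, hre, htr, hrel, hdet⟩ := slot_all hTt hT0 hK (m + 2)
  have hδ : (t (m + 1) : ℚ) ≠ 2 * t m - t 0 := hdet le_rfl
  -- the basis
  set w : Fin (m + 2) → ℂ := fun i => β i.val - (t i.val : ℂ) with hw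
  -- the ambient span `V` and the span `W` of `w`
  set V : Submodule ℚ ℂ := Submodule.span ℚ (Set.range
    (Fin.cons T (Fin.cons (1 : ℂ) u) : Fin (m + 2) → ℂ)) with hV
  have hTV : T ∈ V := Submodule.subset_span ⟨0, rfl⟩
  have h1V : (1 : ℂ) ∈ V := Submodule.subset_span ⟨Fin.succ 0, by simp⟩
  have huV : ∀ j : Fin m, u j ∈ V := fun j => Submodule.subset_span ⟨j.succ.succ, by simp⟩
  have hβV : ∀ s : ℕ, β s ∈ V := by
    intro s
    rcases lt_trichotomy s m with h | rfl | h
    · rw [hβlt s h]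
      exact huV _
    · rw [hβm]
      exact V.add_mem hTV (huV _)
    · rw [hβgt s h, two_mul]
      exact V.add_mem (V.add_mem hTV hTV) (huV _)
  have hnatV : ∀ n : ℕ, (n : ℂ) ∈ V := by
    intro n
    have := V.smul_mem (n : ℚ) h1V
    rwa [Rat.smul_def, mul_one, Rat.cast_natCast] at this
  have hwV : ∀ i, w i ∈ V := fun i => V.sub_mem (hβV _) (hnatV _)
  set W : Submodule ℚ ℂ := Submodule.span ℚ (Set.range w) with hW
  have hwW : ∀ i, w i ∈ W := fun i => Submodule.subset_span ⟨i, rfl⟩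
  -- three named slots
  have hw0 : w ⟨0, by omega⟩ = u j0 - (t 0 : ℂ) := by
    simp only [hw]
    rw [hβlt 0 (by omega)]
  have hwm : w ⟨m, by omega⟩ = T + u j0 - (t m : ℂ) := by
    simp only [hw]
    rw [hβm]
  have hwm1 : w ⟨m + 1, by omega⟩ = 2 * T + u j0 - (t (m + 1) : ℂ) := by
    simp only [hw]
    rw [hβgt (m + 1) (by omega)]
  -- `1 ∈ W` through `δ = w_{m+1} - 2 w_m + w_0 = 2 t_m - t_0 - t_{m+1} ≠ 0`
  have hδ0 : (2 * (t m : ℚ) - t 0 - t (m + 1)) ≠ 0 := sub_ne_zero.2 hδ.symm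
  have hkey : (((2 * (t m : ℚ) - t 0 - t (m + 1)) : ℚ) : ℂ) =
      w ⟨m + 1, by omega⟩ - 2 * w ⟨m, by omega⟩ + w ⟨0, by omega⟩ := by
    rw [hwm1, hwm, hw0]
    push_cast
    ring
  have hδW : (((2 * (t m : ℚ) - t 0 - t (m + 1)) : ℚ) : ℂ) ∈ W := by
    rw [hkey]
    refine W.add_mem (W.sub_mem (hwW _) ?_) (hwW _)
    rw [two_mul]
    exact W.add_mem (hwW _) (hwW _)
  have h1W : (1 : ℂ) ∈ W := by
    have := W.smul_mem ((2 * (t m : ℚ) - t 0 - t (m + 1))⁻¹ : ℚ) hδW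
    rwa [Rat.smul_def, ← Rat.cast_mul, inv_mul_cancel₀ hδ0, Rat.cast_one] at this
  have hnatW : ∀ n : ℕ, (n : ℂ) ∈ W := by
    intro n
    have := W.smul_mem (n : ℚ) h1W
    rwa [Rat.smul_def, mul_one, Rat.cast_natCast] at this
  have huW : ∀ j : Fin m, u j ∈ W := by
    intro j
    have e : u j = w ⟨j.val, by omega⟩ + (t j.val : ℂ) := by
      simp only [hw]
      rw [hβlt j.val j.isLt]
      simp
    rw [e]
    exact W.add_mem (hwW _) (hnatW _)
  have hTW : T ∈ W := by
    have e : T = w ⟨m, by omega⟩ - u j0 + (t m : ℂ) := by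
      rw [hwm]
      ring
    rw [e]
    exact W.add_mem (W.sub_mem (hwW _) (huW _)) (hnatW _)
  have hspan : W = V := by
    apply le_antisymm
    · rw [hW, Submodule.span_le]
      rintro _ ⟨i, rfl⟩
      exact hwV i
    · rw [hV, Submodule.span_le]
      rintro _ ⟨i, rfl⟩
      refine Fin.cases ?_ (fun i => ?_) i
      · simpa using hTW
      · refine Fin.cases ?_ (fun i => ?_) i
        · simpa using h1W
        · simpa using huW i
  refine ⟨w, ?_, ?_, ?_, ?_, ?_⟩
  · -- independence by the `finrank` count
    rw [linearIndependent_iff_card_eq_finrank_span, Fintype.card_fin]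
    show m + 2 = Module.finrank ℚ (Submodule.span ℚ (Set.range w))
    rw [← hW, hspan, hV, finrank_span_eq_card hu, Fintype.card_fin]
  · rw [← hW, hspan]
  · intro j
    have := hre j.val j.isLt
    show (β j.val - (t j.val : ℂ)).re < 0
    rw [Complex.sub_re, Complex.natCast_re]
    linarith
  · intro j
    exact htr j.val j.isLt
  · intro i j hij a b c d hdet' heq
    rcases lt_or_gt_of_ne (fun h : i.val = j.val => hij (Fin.ext h)) with hlt | hlt
    · exact hrel j.val j.isLt i.val hlt ⟨a, b, c, d, hdet', Or.inl heq⟩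
    · exact hrel i.val i.isLt j.val hlt ⟨a, b, c, d, hdet', Or.inr heq⟩

end Summit.Schanuel.Schanuel.Theorems.TateNomesNomeHygiene

end
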